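import Summits.QuantumFields.YangMills.Theorems.BalabanUVNodesN11SupplyChainFirstLink

/-!
# DAG node N11 — THE WITNESS CHAIN CLOSES LEVEL BY LEVEL: the first `k₀` links of a supplier give `ρ_k`'s §2 form — THEOREM 1 OF [III] — at every level `k ≤ k₀`, and read the
# supplier only through its responses BELOW `k₀` along its own chain (two suppliers agreeing there have the same chain up to `k₀`); `k₀ = 1` is this seat's first link,
# `k₀ = K` is dag-n11-e's whole chain

HEADER — WORK-UNIT METADATA.  Cell `pub-ymgap`, YM-PLAN Track A (HUMAN RULING D-0062 ∕ D-0149 width push), seat `pub-ymgap-dag-n08-w2` (g6; WIDTH SEAT 2∕4 on N08 [B10],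
re-pointed by the dag-lead desk to N11's §3-supply residue, DEDUP-354∕355), route `BalabanUVNodes` rev 25 (v1.7 `CoPH` key), item K1⁷ `StabilityBAtRecordR13SepCoPH` =
stmt-QuantumFields-20542; PROOF lane (`--kind proof --supports 20542 --as helper`; theorems only, 0 `def`), count-neutral.  [III] = [Balaban1988Convergent], [IV] = [Balaban1989LargeFieldI].
Over dag-n11-e's `…Sect3SupplyChainDefs ∕ …Sect3SupplyChain ∕ …ObligationsDefs` (p591185 ∕ p591271 ∕ p595576: `chainWitness`, `spliceTermsB ∕ spliceConst`, ★ `formAtZS_succ_of_formT_of_liveSel_of_rstep`,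
★★ `formT_spliceTermsB_of_rows`, `ChainFormAt ∕ ChainFormTAt`, `SupplierObligations`, `NoExpansionObligation`) and this seat's `…N11SupplyChainFirstLink` (p597418: `FirstLinkObligations`).

WHY THIS FILE.  dag-n11-e's `formAtZS_chainWitness` ∕ `chainFormAt_all_of_obligations` run Theorem 1's induction over the WHOLE run: the hypotheses are the supplier's obligations at
EVERY level `k < K` (`SupplierObligations θ p σ`) and the no-expansion obligation at every level, the conclusion is the §2 form at every `k ≤ K`.  But the induction step at level
`k` reads the level-`k` hand-over ONLY, so the chain closes LEVEL BY LEVEL: whoever supplies the first `k₀` links (at `θ`, for the run `p`) has proved Theorem 1 up to level `k₀`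
there, whatever is or is not supplied above — the shape in which [III] §3's content will actually arrive (one renormalization step at a time; at `k₀ = 1` it is [I] Thm 1 + [II],
this seat's first link).  This file states that modularity through dag-n11-e's NAMES, with no new definition:
§1 `chainWitness_eq_of_agree_below` — two suppliers whose responses agree at the levels `< k₀` ALONG THE FIRST ONE's CHAIN have the same chain witness at every level `≤ k₀`
   (the chain up to `k₀` reads the supplier below `k₀` only); `chainFormAt_iff_of_agree_below` ∕ `chainFormTAt_iff_of_agree_below`.
§2 ★ `chainFormAt_succ_of_link` — ONE LINK ADVANCES THE CHAIN ONE LEVEL: `ChainFormAt θ p σ k` + the level-`k` hand-over (universality in 𝐄 of the response, its four 𝐄-clauses at every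
   history, `PresentChildObligations` at the 𝐓-present expansion children, dag-n11-d's `NoExpansionClauseFor` for the level-`k` chain witness) ⇒ `ChainFormTAt θ p σ k` and, on the
   live-selector line (core provisos — row `rstep` —, selector clause, admissibility, `0 ≤ κ, E₀, B₀`, `1 ≤ M`, `k < K`), `ChainFormAt θ p σ (k+1)` — dag-n11-e's 𝐓-step ★★ and 𝐑-step ★
   composed through the names.
§3 ★★ `chainFormAt_of_links_below` — THE FIRST `k₀` LINKS GIVE THE FORM AT EVERY LEVEL `k ≤ k₀` (`k₀ ≤ K`; each link may assume the form at its own level, as in print's induction);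
   ★★ `sLaw₁₃CoPH_of_links_below` (Theorem 1 up to level `k₀`) · `tLaw₁₃CoPH_of_links_below` (the 𝐓-images below `k₀`) · `thmP245Laws_of_links_below` (the law form of the Theorem of
   p. 245 below `k₀`).
§4 the two ends recovered BY NAME: `k₀ = K` from `SupplierObligations ∧ NoExpansionObligation` is dag-n11-e's `chainFormAt_all_of_obligations` (`chainFormAt_all_of_obligations'`, one line
   over §3); `k₀ = 1` from this seat's `FirstLinkObligations` + the level-`0` no-expansion clause is p597418's `FirstLinkObligations.chainFormAt_one` (`chainFormAt_le_one_of_firstLink`).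
§5 ★ LOCALITY IN THE SUPPLIER: Theorem 1 up to level `k₀` from the links below `k₀` of ANY supplier agreeing with `σ` below `k₀` along `σ`'s chain (`sLaw₁₃CoPH_of_links_below_of_agree_below`)
   — a supplier may be EXTENDED level by level without re-proving the levels already closed.
§6 at any H-extension of the witness of record: §3 with selector `rfl`, admissibility, the signs and `M = 1` discharged (`sLaw₁₃CoPH_theta13LiveOfRecordH_of_links_below`).

HONEST FRAMING.  Count-neutral KERNEL BOOKKEEPING: one induction on the level (twice) over landed definitions and dag-n11-e's two step theorems; every link is a DISPLAYED hypothesis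
([III] §3's content at that level — nobody's theorem in the tree; at level `0` it is [I] Thm 1 + [II]); nothing of Bałaban asserted; N11 NOT discharged; N08 untouched; K1⁷ NOT
closed; counts unmoved (typed 28∕28 · discharged 5∕27).  One finite `𝕋⁴_{L^K}` programme at fixed `ε = L^{−K}`; R4 closes only the conditional finite-𝕋⁴ rung `BalabanLadder.UV` — NOT
ℝ⁴, NOT OS, NOT a mass gap, NOT Clay.  No `sorry`, no `axiom`, no `def`, no `instance`, no `notation`.
Sources (SHAPE only): [III] Theorem p.245, Thm 1 p.262, Thm 2 p.263, §2 p.262, §3 p.279, (3.1) p.264, (3.24)–(3.25) p.270, (2.17)–(2.18) p.257, (2.23)–(2.31) pp.258–260,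
(2.40)–(2.42) p.261; [IV] (0.2)–(0.4) p.176, p.177 (i)–(ii).
-/

noncomputable section

open MeasureTheory
open scoped BigOperators Matrix.Norms.L2Operator

namespace Summit.QuantumFields.YangMills.Theorems.BalabanUVNodesN11SupplyChainLevelByLevel

open Literature.MathematicalPhysics.QuantumFieldTheory.Balaban1983to89 T4Continuum Node00 Node00.Tk
open Literature.MathematicalPhysics.QuantumFieldTheory.Balaban1983to89.B16RLeafRecord13AtLive (kappa_nonneg_theta13LiveOfFamily E0_nonneg_theta13LiveOfFamily
  B0_nonneg_theta13LiveOfFamily)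
open BalabanUVNodesN11Sect3SupplyChainDefs
open BalabanUVNodesN11Sect3SupplyChain (formT_spliceTermsB_of_rows formAtZS_succ_of_formT_of_liveSel_of_rstep)
open BalabanUVNodesN11Sect3SupplyChainObligationsDefs
open BalabanUVNodesN11SupplyChainFirstLink (FirstLinkObligations presentChildObligations_zero_iff)

variable {F : T4Family} {N : ℕ} [NeZero N]
variable {θ : Stage13HParams F N} {p : B12.RunParams}

/-! ## §1. The chain up to level `k₀` reads the supplier below `k₀` only -/

section Agree

/-- **TWO SUPPLIERS AGREEING BELOW `k₀` ALONG THE FIRST ONE's CHAIN HAVE THE SAME CHAIN UP TO `k₀`**: if `σ′ k` and `σ k` give the same response to `σ`'s level-`k` chain witness for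
every `k < k₀`, then `chainWitness θ p σ′ k = chainWitness θ p σ k` for every `k ≤ k₀` (induction: both start at def-T's base witness; the splice at `k` reads the level-`k` witness and
the response to it).  The levels `≥ k₀` of `σ′` are free. [cite: Balaban1988Convergent, Thm 1 p.262, §3 p.279, (3.24)–(3.25) p.270 (bookkeeping)] -/
theorem chainWitness_eq_of_agree_below (σ σ' : Sect3Supplier θ p) (k₀ : ℕ)
    (hag : ∀ k, k < k₀ → σ' k (chainWitness θ p σ k).1 (chainWitness θ p σ k).2 = σ k (chainWitness θ p σ k).1 (chainWitness θ p σ k).2) :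
    ∀ k, k ≤ k₀ → chainWitness θ p σ' k = chainWitness θ p σ k := by
  intro k
  induction k with
  | zero => exact fun _ => rfl
  | succ k ih =>
    intro hk
    have hk' : k < k₀ := Nat.lt_of_succ_le hk
    rw [chainWitness_succ, chainWitness_succ, ih hk'.le, hag k hk']

/-- … hence the same §2-form statements up to `k₀` (`ChainFormAt` reads the chain witness only). [cite: Balaban1988Convergent, Thm 1 p.262 (bookkeeping)] -/
theorem chainFormAt_iff_of_agree_below (σ σ' : Sect3Supplier θ p) (k₀ : ℕ)
    (hag : ∀ k, k < k₀ → σ' k (chainWitness θ p σ k).1 (chainWitness θ p σ k).2 = σ k (chainWitness θ p σ k).1 (chainWitness θ p σ k).2)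
    {k : ℕ} (hk : k ≤ k₀) : ChainFormAt θ p σ' k ↔ ChainFormAt θ p σ k := by
  unfold ChainFormAt
  rw [chainWitness_eq_of_agree_below σ σ' k₀ hag k hk]

/-- … and the same 𝐓-image statements below `k₀` (`ChainFormTAt … k` reads the chain witness at `k + 1 ≤ k₀`). [cite: Balaban1988Convergent, remark p.262, (3.25) p.270 (bookkeeping)] -/
theorem chainFormTAt_iff_of_agree_below (σ σ' : Sect3Supplier θ p) (k₀ : ℕ)
    (hag : ∀ k, k < k₀ → σ' k (chainWitness θ p σ k).1 (chainWitness θ p σ k).2 = σ k (chainWitness θ p σ k).1 (chainWitness θ p σ k).2)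
    {k : ℕ} (hk : k < k₀) : ChainFormTAt θ p σ' k ↔ ChainFormTAt θ p σ k := by
  unfold ChainFormTAt
  rw [chainWitness_eq_of_agree_below σ σ' k₀ hag (k + 1) hk]

end Agree

/-! ## §2. One link advances the chain one level -/

section Step

/-- **★ ONE LINK GIVES THE 𝐓-IMAGE AT ITS LEVEL**: from `ChainFormAt θ p σ k` and the level-`k` hand-over — the response universal in 𝐄, its four 𝐄-clauses at every history of length
`k+1`, `PresentChildObligations` at every 𝐓-present expansion child, dag-n11-d's `NoExpansionClauseFor` for the level-`k` chain witness — the level-`(k+1)` chain witness is a 𝐓-image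
witness at level `k` (`ChainFormTAt θ p σ k`; dag-n11-e's ★★ `formT_spliceTermsB_of_rows` through the names; `1 ≤ M`, `0 ≤ B₀`).  NO other level is read.
[cite: Balaban1988Convergent, Theorem p.245, §3 p.279, (3.24)–(3.25) p.270, (3.1) p.264, (2.25)–(2.31) pp.259–260, (2.40)–(2.42) p.261] -/
theorem chainFormTAt_of_link (hM : 1 ≤ θ.τ9.M) (hB₀ : 0 ≤ θ.s2.lf.B₀) (σ : Sect3Supplier θ p) {k : ℕ} (hform : ChainFormAt θ p σ k)
    (huE : Sect2.UniversalE (σ k (chainWitness θ p σ k).1 (chainWitness θ p σ k).2).1)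
    (hOE : ∀ s : SeqOfRecord F θ.ν θ.τ9.M (gOfRecord₁₃ F N θ.toStage13Params p) p.K (k + 1), NewEClausesAt θ p k ((σ k (chainWitness θ p σ k).1 (chainWitness θ p σ k).2).1 s) s)
    (hpres : ∀ s : SeqOfRecord F θ.ν θ.τ9.M (gOfRecord₁₃ F N θ.toStage13Params p) p.K (k + 1), s.Ω (k + 1) ≠ ∅ →
      slotsTOfRecord F N θ.ν θ.τ9 (EOfRecord₁₃ F N θ.toStage13Params) (wOfRecord₉ F N θ.toStage9Params) θ.ppSel p (gOfRecord₁₃ F N θ.toStage13Params p) (k + 1) s ≠ 0 →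
      PresentChildObligations θ p k (chainWitness θ p σ k).1 (σ k (chainWitness θ p σ k).1 (chainWitness θ p σ k).2).1 (σ k (chainWitness θ p σ k).1 (chainWitness θ p σ k).2).2 s)
    (hTcl : NoExpansionClauseFor θ p k (chainWitness θ p σ k).1 (chainWitness θ p σ k).2) : ChainFormTAt θ p σ k :=
  formT_spliceTermsB_of_rows θ p hM hB₀ _ _ hform _ _ huE hOE hpres hTcl

/-- **★ ONE LINK ADVANCES THE CHAIN ONE LEVEL**: on the live-selector line (core provisos — row `rstep` —, selector clause, admissibility, `0 ≤ κ, E₀, B₀`, `1 ≤ M`, `k < K`),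
`ChainFormAt θ p σ k` and the level-`k` hand-over give `ChainFormAt θ p σ (k+1)` — the 𝐓-step above followed by dag-n11-e's 𝐑-step ★ `formAtZS_succ_of_formT_of_liveSel_of_rstep`.
Print's induction step of Thm 1, p. 262, through the names; NO other level is read. [cite: Balaban1988Convergent, Thm 1 p.262, §2 p.262, Thm 2 p.263, Theorem p.245, (3.24)–(3.25) p.270; Balaban1989LargeFieldI, (0.2)–(0.4) p.176, p.177 (i)–(ii)] -/
theorem chainFormAt_succ_of_link (h : θ.Provisos₁₃CoPH F N)
    (hsel : θ.ppSel = ppSelLiveOfRecord F N θ.ν θ.τ9 (EOfRecord₁₃ F N θ.toStage13Params) (wOfRecord₉ F N θ.toStage9Params))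
    (hθ : θ.Admissible F N) (hκ : 0 ≤ θ.s2.lf.κ) (hE₀ : 0 ≤ θ.s2.lf.E₀) (hB₀ : 0 ≤ θ.s2.lf.B₀) (hM : 1 ≤ θ.τ9.M) (σ : Sect3Supplier θ p) {k : ℕ} (hk : k < p.K)
    (hform : ChainFormAt θ p σ k) (huE : Sect2.UniversalE (σ k (chainWitness θ p σ k).1 (chainWitness θ p σ k).2).1)
    (hOE : ∀ s : SeqOfRecord F θ.ν θ.τ9.M (gOfRecord₁₃ F N θ.toStage13Params p) p.K (k + 1), NewEClausesAt θ p k ((σ k (chainWitness θ p σ k).1 (chainWitness θ p σ k).2).1 s) s)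
    (hpres : ∀ s : SeqOfRecord F θ.ν θ.τ9.M (gOfRecord₁₃ F N θ.toStage13Params p) p.K (k + 1), s.Ω (k + 1) ≠ ∅ →
      slotsTOfRecord F N θ.ν θ.τ9 (EOfRecord₁₃ F N θ.toStage13Params) (wOfRecord₉ F N θ.toStage9Params) θ.ppSel p (gOfRecord₁₃ F N θ.toStage13Params p) (k + 1) s ≠ 0 →
      PresentChildObligations θ p k (chainWitness θ p σ k).1 (σ k (chainWitness θ p σ k).1 (chainWitness θ p σ k).2).1 (σ k (chainWitness θ p σ k).1 (chainWitness θ p σ k).2).2 s)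
    (hTcl : NoExpansionClauseFor θ p k (chainWitness θ p σ k).1 (chainWitness θ p σ k).2) : ChainFormAt θ p σ (k + 1) :=
  formAtZS_succ_of_formT_of_liveSel_of_rstep θ p h hsel hθ hκ hE₀ hB₀ hk _ _ (chainFormTAt_of_link hM hB₀ σ hform huE hOE hpres hTcl)

end Step

/-! ## §3. The first `k₀` links give the §2 form — Theorem 1 — at every level `k ≤ k₀` -/

section Below

/-- **★★ THE CHAIN CLOSES LEVEL BY LEVEL — THE FIRST `k₀` LINKS GIVE `ρ_k`'s §2 FORM AT EVERY `k ≤ k₀`** (`k₀ ≤ K`; live-selector line): if at every level `k < k₀`, GIVEN the form at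
`k` (print's inductive hypothesis), the supplier's response is universal in 𝐄, carries the four 𝐄-clauses at every history and `PresentChildObligations` at the 𝐓-present expansion
children, and the level-`k` chain witness has dag-n11-d's no-expansion clause, then `ChainFormAt θ p σ k` for every `k ≤ k₀` — induction on `k` by §2; the levels `≥ k₀` are never read.
dag-n11-e's `formAtZS_chainWitness` is the case `k₀ = K`. [cite: Balaban1988Convergent, Thm 1 p.262, Theorem p.245, §3 p.279, (3.24)–(3.25) p.270; Balaban1989LargeFieldI, (0.2)–(0.4) p.176, p.177 (i)–(ii)] -/
theorem chainFormAt_of_links_below (h : θ.Provisos₁₃CoPH F N)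
    (hsel : θ.ppSel = ppSelLiveOfRecord F N θ.ν θ.τ9 (EOfRecord₁₃ F N θ.toStage13Params) (wOfRecord₉ F N θ.toStage9Params))
    (hθ : θ.Admissible F N) (hκ : 0 ≤ θ.s2.lf.κ) (hE₀ : 0 ≤ θ.s2.lf.E₀) (hB₀ : 0 ≤ θ.s2.lf.B₀) (hM : 1 ≤ θ.τ9.M) (σ : Sect3Supplier θ p) (k₀ : ℕ) (hk₀ : k₀ ≤ p.K)
    (hlinks : ∀ k, k < k₀ → ChainFormAt θ p σ k →
      Sect2.UniversalE (σ k (chainWitness θ p σ k).1 (chainWitness θ p σ k).2).1 ∧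
      (∀ s : SeqOfRecord F θ.ν θ.τ9.M (gOfRecord₁₃ F N θ.toStage13Params p) p.K (k + 1), NewEClausesAt θ p k ((σ k (chainWitness θ p σ k).1 (chainWitness θ p σ k).2).1 s) s) ∧
      (∀ s : SeqOfRecord F θ.ν θ.τ9.M (gOfRecord₁₃ F N θ.toStage13Params p) p.K (k + 1), s.Ω (k + 1) ≠ ∅ →
        slotsTOfRecord F N θ.ν θ.τ9 (EOfRecord₁₃ F N θ.toStage13Params) (wOfRecord₉ F N θ.toStage9Params) θ.ppSel p (gOfRecord₁₃ F N θ.toStage13Params p) (k + 1) s ≠ 0 →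
        PresentChildObligations θ p k (chainWitness θ p σ k).1 (σ k (chainWitness θ p σ k).1 (chainWitness θ p σ k).2).1 (σ k (chainWitness θ p σ k).1 (chainWitness θ p σ k).2).2 s) ∧
      NoExpansionClauseFor θ p k (chainWitness θ p σ k).1 (chainWitness θ p σ k).2) :
    ∀ k, k ≤ k₀ → ChainFormAt θ p σ k := by
  intro k
  induction k with
  | zero => exact fun _ => chainFormAt_zero σ
  | succ k ih =>
    intro hk
    have hk' : k < k₀ := Nat.lt_of_succ_le hk
    have hform := ih hk'.le
    obtain ⟨huE, hOE, hpres, hTcl⟩ := hlinks k hk' hform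
    exact chainFormAt_succ_of_link h hsel hθ hκ hE₀ hB₀ hM σ (lt_of_lt_of_le hk' hk₀) hform huE hOE hpres hTcl

/-- **★★ THEOREM 1 OF [III] UP TO LEVEL `k₀` FROM THE FIRST `k₀` LINKS** — `∀ k ≤ k₀, SLaw₁₃CoPH θ p k` (def-T's `sLaw₁₃CoPH_iff` at the chain witness).
[cite: Balaban1988Convergent, Thm 1 p.262, Theorem p.245; Balaban1989LargeFieldI, (0.2)–(0.4) p.176] -/
theorem sLaw₁₃CoPH_of_links_below (h : θ.Provisos₁₃CoPH F N)
    (hsel : θ.ppSel = ppSelLiveOfRecord F N θ.ν θ.τ9 (EOfRecord₁₃ F N θ.toStage13Params) (wOfRecord₉ F N θ.toStage9Params))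
    (hθ : θ.Admissible F N) (hκ : 0 ≤ θ.s2.lf.κ) (hE₀ : 0 ≤ θ.s2.lf.E₀) (hB₀ : 0 ≤ θ.s2.lf.B₀) (hM : 1 ≤ θ.τ9.M) (σ : Sect3Supplier θ p) (k₀ : ℕ) (hk₀ : k₀ ≤ p.K)
    (hlinks : ∀ k, k < k₀ → ChainFormAt θ p σ k →
      Sect2.UniversalE (σ k (chainWitness θ p σ k).1 (chainWitness θ p σ k).2).1 ∧
      (∀ s : SeqOfRecord F θ.ν θ.τ9.M (gOfRecord₁₃ F N θ.toStage13Params p) p.K (k + 1), NewEClausesAt θ p k ((σ k (chainWitness θ p σ k).1 (chainWitness θ p σ k).2).1 s) s) ∧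
      (∀ s : SeqOfRecord F θ.ν θ.τ9.M (gOfRecord₁₃ F N θ.toStage13Params p) p.K (k + 1), s.Ω (k + 1) ≠ ∅ →
        slotsTOfRecord F N θ.ν θ.τ9 (EOfRecord₁₃ F N θ.toStage13Params) (wOfRecord₉ F N θ.toStage9Params) θ.ppSel p (gOfRecord₁₃ F N θ.toStage13Params p) (k + 1) s ≠ 0 →
        PresentChildObligations θ p k (chainWitness θ p σ k).1 (σ k (chainWitness θ p σ k).1 (chainWitness θ p σ k).2).1 (σ k (chainWitness θ p σ k).1 (chainWitness θ p σ k).2).2 s) ∧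
      NoExpansionClauseFor θ p k (chainWitness θ p σ k).1 (chainWitness θ p σ k).2) :
    ∀ k, k ≤ k₀ → SLaw₁₃CoPH F N θ p k := fun k hk =>
  sLaw₁₃CoPH_of_chainFormAt (chainFormAt_of_links_below h hsel hθ hκ hE₀ hB₀ hM σ k₀ hk₀ hlinks k hk)

/-- **★ THE 𝐓-IMAGES BELOW `k₀` FROM THE FIRST `k₀` LINKS** — `∀ k < k₀, TLaw₁₃CoPH θ p k` (the form at `k` by §3, then §2's 𝐓-step at `k`).
[cite: Balaban1988Convergent, Theorem p.245, remark p.262, §3 p.279, (3.25) p.270] -/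
theorem tLaw₁₃CoPH_of_links_below (h : θ.Provisos₁₃CoPH F N)
    (hsel : θ.ppSel = ppSelLiveOfRecord F N θ.ν θ.τ9 (EOfRecord₁₃ F N θ.toStage13Params) (wOfRecord₉ F N θ.toStage9Params))
    (hθ : θ.Admissible F N) (hκ : 0 ≤ θ.s2.lf.κ) (hE₀ : 0 ≤ θ.s2.lf.E₀) (hB₀ : 0 ≤ θ.s2.lf.B₀) (hM : 1 ≤ θ.τ9.M) (σ : Sect3Supplier θ p) (k₀ : ℕ) (hk₀ : k₀ ≤ p.K)
    (hlinks : ∀ k, k < k₀ → ChainFormAt θ p σ k →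
      Sect2.UniversalE (σ k (chainWitness θ p σ k).1 (chainWitness θ p σ k).2).1 ∧
      (∀ s : SeqOfRecord F θ.ν θ.τ9.M (gOfRecord₁₃ F N θ.toStage13Params p) p.K (k + 1), NewEClausesAt θ p k ((σ k (chainWitness θ p σ k).1 (chainWitness θ p σ k).2).1 s) s) ∧
      (∀ s : SeqOfRecord F θ.ν θ.τ9.M (gOfRecord₁₃ F N θ.toStage13Params p) p.K (k + 1), s.Ω (k + 1) ≠ ∅ →
        slotsTOfRecord F N θ.ν θ.τ9 (EOfRecord₁₃ F N θ.toStage13Params) (wOfRecord₉ F N θ.toStage9Params) θ.ppSel p (gOfRecord₁₃ F N θ.toStage13Params p) (k + 1) s ≠ 0 →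
        PresentChildObligations θ p k (chainWitness θ p σ k).1 (σ k (chainWitness θ p σ k).1 (chainWitness θ p σ k).2).1 (σ k (chainWitness θ p σ k).1 (chainWitness θ p σ k).2).2 s) ∧
      NoExpansionClauseFor θ p k (chainWitness θ p σ k).1 (chainWitness θ p σ k).2) :
    ∀ k, k < k₀ → TLaw₁₃CoPH F N θ p k := fun k hk => by
  have hform := chainFormAt_of_links_below h hsel hθ hκ hE₀ hB₀ hM σ k₀ hk₀ hlinks k hk.le
  obtain ⟨huE, hOE, hpres, hTcl⟩ := hlinks k hk hform
  exact tLaw₁₃CoPH_of_chainFormTAt (chainFormTAt_of_link hM hB₀ σ hform huE hOE hpres hTcl)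

/-- **★ THE THEOREM OF p. 245 IN LAW FORM BELOW `k₀` FROM THE FIRST `k₀` LINKS** — `∀ k < k₀, SLaw₁₃CoPH θ p k → TLaw₁₃CoPH θ p k` (the antecedent is not even read: the chain
carries its own witness). [cite: Balaban1988Convergent, Theorem p.245, Thm 1 p.262, remark p.262] -/
theorem thmP245Laws_of_links_below (h : θ.Provisos₁₃CoPH F N)
    (hsel : θ.ppSel = ppSelLiveOfRecord F N θ.ν θ.τ9 (EOfRecord₁₃ F N θ.toStage13Params) (wOfRecord₉ F N θ.toStage9Params))
    (hθ : θ.Admissible F N) (hκ : 0 ≤ θ.s2.lf.κ) (hE₀ : 0 ≤ θ.s2.lf.E₀) (hB₀ : 0 ≤ θ.s2.lf.B₀) (hM : 1 ≤ θ.τ9.M) (σ : Sect3Supplier θ p) (k₀ : ℕ) (hk₀ : k₀ ≤ p.K)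
    (hlinks : ∀ k, k < k₀ → ChainFormAt θ p σ k →
      Sect2.UniversalE (σ k (chainWitness θ p σ k).1 (chainWitness θ p σ k).2).1 ∧
      (∀ s : SeqOfRecord F θ.ν θ.τ9.M (gOfRecord₁₃ F N θ.toStage13Params p) p.K (k + 1), NewEClausesAt θ p k ((σ k (chainWitness θ p σ k).1 (chainWitness θ p σ k).2).1 s) s) ∧
      (∀ s : SeqOfRecord F θ.ν θ.τ9.M (gOfRecord₁₃ F N θ.toStage13Params p) p.K (k + 1), s.Ω (k + 1) ≠ ∅ →
        slotsTOfRecord F N θ.ν θ.τ9 (EOfRecord₁₃ F N θ.toStage13Params) (wOfRecord₉ F N θ.toStage9Params) θ.ppSel p (gOfRecord₁₃ F N θ.toStage13Params p) (k + 1) s ≠ 0 →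
        PresentChildObligations θ p k (chainWitness θ p σ k).1 (σ k (chainWitness θ p σ k).1 (chainWitness θ p σ k).2).1 (σ k (chainWitness θ p σ k).1 (chainWitness θ p σ k).2).2 s) ∧
      NoExpansionClauseFor θ p k (chainWitness θ p σ k).1 (chainWitness θ p σ k).2) :
    ∀ k, k < k₀ → SLaw₁₃CoPH F N θ p k → TLaw₁₃CoPH F N θ p k := fun k hk _ =>
  tLaw₁₃CoPH_of_links_below h hsel hθ hκ hE₀ hB₀ hM σ k₀ hk₀ hlinks k hk

end Below

/-! ## §4. The two ends recovered by name: the whole run (`k₀ = K`, dag-n11-e) and the first link (`k₀ = 1`, this seat) -/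

section Ends

/-- **`k₀ = K`: A SUPPLIER CARRYING ITS OBLIGATIONS AND THE NO-EXPANSION OBLIGATION SUPPLIES EVERY LINK**, so §3 returns dag-n11-e's `chainFormAt_all_of_obligations` (cited; one line).
[cite: Balaban1988Convergent, Thm 1 p.262, §3 p.279 (bookkeeping)] -/
theorem chainFormAt_all_of_obligations' (h : θ.Provisos₁₃CoPH F N)
    (hsel : θ.ppSel = ppSelLiveOfRecord F N θ.ν θ.τ9 (EOfRecord₁₃ F N θ.toStage13Params) (wOfRecord₉ F N θ.toStage9Params))
    (hθ : θ.Admissible F N) (hκ : 0 ≤ θ.s2.lf.κ) (hE₀ : 0 ≤ θ.s2.lf.E₀) (hB₀ : 0 ≤ θ.s2.lf.B₀) (hM : 1 ≤ θ.τ9.M) (σ : Sect3Supplier θ p)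
    (hσ : SupplierObligations θ p σ) (hT : NoExpansionObligation θ p σ) : ∀ k, k ≤ p.K → ChainFormAt θ p σ k :=
  chainFormAt_of_links_below h hsel hθ hκ hE₀ hB₀ hM σ p.K le_rfl fun k hk hform =>
    ⟨hσ.univE k hk hform, hσ.newE k hk hform, hσ.present k hk hform, hT k hk hform⟩

/-- **`k₀ = 1`: THE FIRST LINK AND THE LEVEL-`0` NO-EXPANSION CLAUSE SUPPLY THE ONLY LINK BELOW `1`** ((present) in p597418's first-step currency via ★ `presentChildObligations_zero_iff`),
so §3 returns p597418's `FirstLinkObligations.chainFormAt_one` at `k = 1` (`0 < K`). [cite: Balaban1988Convergent, Thm 1 p.262, §3 p.279; Balaban1987RG1, Thm 1 p.258] -/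
theorem chainFormAt_le_one_of_firstLink (h : θ.Provisos₁₃CoPH F N)
    (hsel : θ.ppSel = ppSelLiveOfRecord F N θ.ν θ.τ9 (EOfRecord₁₃ F N θ.toStage13Params) (wOfRecord₉ F N θ.toStage9Params))
    (hθ : θ.Admissible F N) (hκ : 0 ≤ θ.s2.lf.κ) (hE₀ : 0 ≤ θ.s2.lf.E₀) (hB₀ : 0 ≤ θ.s2.lf.B₀) (hM : 1 ≤ θ.τ9.M) (hK : 0 < p.K) {σ : Sect3Supplier θ p}
    (hlink : FirstLinkObligations θ p σ) (hTcl : NoExpansionClauseFor θ p 0 (chainWitness θ p σ 0).1 (chainWitness θ p σ 0).2) : ∀ k, k ≤ 1 → ChainFormAt θ p σ k :=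
  chainFormAt_of_links_below h hsel hθ hκ hE₀ hB₀ hM σ 1 hK fun k hk _ => by
    obtain rfl : k = 0 := Nat.lt_one_iff.mp hk
    exact ⟨hlink.univE, hlink.newE, fun s hΩ h0 => (presentChildObligations_zero_iff _ _ _ s).mpr (hlink.present s hΩ h0), hTcl⟩

end Ends

/-! ## §5. Locality in the supplier: the levels already closed are not re-proved when the supplier is extended -/

section Locality

/-- **★ THEOREM 1 UP TO LEVEL `k₀` FOR `σ′` FROM THE LINKS BELOW `k₀` OF ANY SUPPLIER `σ` WITH WHICH `σ′` AGREES BELOW `k₀` ALONG `σ`'s CHAIN** (§1 + §3): extending a supplier above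
the levels it has closed costs nothing below. [cite: Balaban1988Convergent, Thm 1 p.262, §3 p.279, (3.24)–(3.25) p.270 (bookkeeping)] -/
theorem chainFormAt_of_links_below_of_agree_below (h : θ.Provisos₁₃CoPH F N)
    (hsel : θ.ppSel = ppSelLiveOfRecord F N θ.ν θ.τ9 (EOfRecord₁₃ F N θ.toStage13Params) (wOfRecord₉ F N θ.toStage9Params))
    (hθ : θ.Admissible F N) (hκ : 0 ≤ θ.s2.lf.κ) (hE₀ : 0 ≤ θ.s2.lf.E₀) (hB₀ : 0 ≤ θ.s2.lf.B₀) (hM : 1 ≤ θ.τ9.M) (σ σ' : Sect3Supplier θ p) (k₀ : ℕ) (hk₀ : k₀ ≤ p.K)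
    (hag : ∀ k, k < k₀ → σ' k (chainWitness θ p σ k).1 (chainWitness θ p σ k).2 = σ k (chainWitness θ p σ k).1 (chainWitness θ p σ k).2)
    (hlinks : ∀ k, k < k₀ → ChainFormAt θ p σ k →
      Sect2.UniversalE (σ k (chainWitness θ p σ k).1 (chainWitness θ p σ k).2).1 ∧
      (∀ s : SeqOfRecord F θ.ν θ.τ9.M (gOfRecord₁₃ F N θ.toStage13Params p) p.K (k + 1), NewEClausesAt θ p k ((σ k (chainWitness θ p σ k).1 (chainWitness θ p σ k).2).1 s) s) ∧
      (∀ s : SeqOfRecord F θ.ν θ.τ9.M (gOfRecord₁₃ F N θ.toStage13Params p) p.K (k + 1), s.Ω (k + 1) ≠ ∅ →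
        slotsTOfRecord F N θ.ν θ.τ9 (EOfRecord₁₃ F N θ.toStage13Params) (wOfRecord₉ F N θ.toStage9Params) θ.ppSel p (gOfRecord₁₃ F N θ.toStage13Params p) (k + 1) s ≠ 0 →
        PresentChildObligations θ p k (chainWitness θ p σ k).1 (σ k (chainWitness θ p σ k).1 (chainWitness θ p σ k).2).1 (σ k (chainWitness θ p σ k).1 (chainWitness θ p σ k).2).2 s) ∧
      NoExpansionClauseFor θ p k (chainWitness θ p σ k).1 (chainWitness θ p σ k).2) :
    ∀ k, k ≤ k₀ → ChainFormAt θ p σ' k := fun k hk =>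
  (chainFormAt_iff_of_agree_below σ σ' k₀ hag hk).mpr (chainFormAt_of_links_below h hsel hθ hκ hE₀ hB₀ hM σ k₀ hk₀ hlinks k hk)

/-- **… HENCE `∀ k ≤ k₀, SLaw₁₃CoPH θ p k`** — stated σ-free (the law does not name the supplier; recorded for the extension pattern: close `k₀` levels with `σ`, extend to `σ′` above,
keep the levels). [cite: Balaban1988Convergent, Thm 1 p.262, Theorem p.245 (bookkeeping)] -/
theorem sLaw₁₃CoPH_of_links_below_of_agree_below (h : θ.Provisos₁₃CoPH F N)
    (hsel : θ.ppSel = ppSelLiveOfRecord F N θ.ν θ.τ9 (EOfRecord₁₃ F N θ.toStage13Params) (wOfRecord₉ F N θ.toStage9Params))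
    (hθ : θ.Admissible F N) (hκ : 0 ≤ θ.s2.lf.κ) (hE₀ : 0 ≤ θ.s2.lf.E₀) (hB₀ : 0 ≤ θ.s2.lf.B₀) (hM : 1 ≤ θ.τ9.M) (σ σ' : Sect3Supplier θ p) (k₀ : ℕ) (hk₀ : k₀ ≤ p.K)
    (hag : ∀ k, k < k₀ → σ' k (chainWitness θ p σ k).1 (chainWitness θ p σ k).2 = σ k (chainWitness θ p σ k).1 (chainWitness θ p σ k).2)
    (hlinks : ∀ k, k < k₀ → ChainFormAt θ p σ k →
      Sect2.UniversalE (σ k (chainWitness θ p σ k).1 (chainWitness θ p σ k).2).1 ∧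
      (∀ s : SeqOfRecord F θ.ν θ.τ9.M (gOfRecord₁₃ F N θ.toStage13Params p) p.K (k + 1), NewEClausesAt θ p k ((σ k (chainWitness θ p σ k).1 (chainWitness θ p σ k).2).1 s) s) ∧
      (∀ s : SeqOfRecord F θ.ν θ.τ9.M (gOfRecord₁₃ F N θ.toStage13Params p) p.K (k + 1), s.Ω (k + 1) ≠ ∅ →
        slotsTOfRecord F N θ.ν θ.τ9 (EOfRecord₁₃ F N θ.toStage13Params) (wOfRecord₉ F N θ.toStage9Params) θ.ppSel p (gOfRecord₁₃ F N θ.toStage13Params p) (k + 1) s ≠ 0 →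
        PresentChildObligations θ p k (chainWitness θ p σ k).1 (σ k (chainWitness θ p σ k).1 (chainWitness θ p σ k).2).1 (σ k (chainWitness θ p σ k).1 (chainWitness θ p σ k).2).2 s) ∧
      NoExpansionClauseFor θ p k (chainWitness θ p σ k).1 (chainWitness θ p σ k).2) :
    ∀ k, k ≤ k₀ → SLaw₁₃CoPH F N θ p k := fun k hk =>
  sLaw₁₃CoPH_of_chainFormAt (chainFormAt_of_links_below_of_agree_below h hsel hθ hκ hE₀ hB₀ hM σ σ' k₀ hk₀ hag hlinks k hk)

end Locality

/-! ## §6. At the H-extensions of the witness of record: selector, admissibility, signs and `M = 1` discharged -/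

section Record

variable (F N)
variable {Zr : (q : B12.RunParams) → TkResidualW F N (FluctV N) q.K}
  {Zh : (q : B12.RunParams) → ℕ → (ℕ → Set (Site (F.P q.K) 0)) → (ℕ → Set (Site (F.P q.K) 0)) → TkResidualW F N (FluctV N) q.K}
  {Phih : (q : B12.RunParams) → ℕ → (ℕ → Set (Site (F.P q.K) 0)) → (ℕ → Set (Site (F.P q.K) 0)) → (ℕ → Plaq (F.P q.K) 0 → ℝ)} (p : B12.RunParams)

/-- **★ THEOREM 1 OF [III] UP TO LEVEL `k₀` AT ANY H-EXTENSION `⟨⟨θ₁₃, Zr⟩, Zh, Phih⟩` OF THE WITNESS OF RECORD FROM `hrec` (the datum's key) AND THE FIRST `k₀` LINKS — NOTHING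
ELSE**: selector `rfl` (K0a's live re-pin), `admissible_theta13LiveOfRecord`, the family's `0 ≤ κ, E₀, B₀` and `M = 1`. [cite: Balaban1988Convergent, Thm 1 p.262, Theorem p.245, p.244, (3.24)–(3.25) p.270, (1.11) p.248; Balaban1989LargeFieldI, (0.3)–(0.4) p.176, p.177 (i)–(ii)] -/
theorem sLaw₁₃CoPH_theta13LiveOfRecordH_of_links_below
    (hrec : (⟨⟨theta13LiveOfRecord F N, Zr⟩, Zh, Phih⟩ : Stage13HParams F N).Provisos₁₃CoPH F N)
    (σ : Sect3Supplier (⟨⟨theta13LiveOfRecord F N, Zr⟩, Zh, Phih⟩ : Stage13HParams F N) p) (k₀ : ℕ) (hk₀ : k₀ ≤ p.K)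
    (hlinks : ∀ k, k < k₀ → ChainFormAt (⟨⟨theta13LiveOfRecord F N, Zr⟩, Zh, Phih⟩ : Stage13HParams F N) p σ k →
      Sect2.UniversalE (σ k (chainWitness _ p σ k).1 (chainWitness _ p σ k).2).1 ∧
      (∀ s, NewEClausesAt (⟨⟨theta13LiveOfRecord F N, Zr⟩, Zh, Phih⟩ : Stage13HParams F N) p k ((σ k (chainWitness _ p σ k).1 (chainWitness _ p σ k).2).1 s) s) ∧
      (∀ s, s.Ω (k + 1) ≠ ∅ →
        slotsTOfRecord F N (theta13LiveOfRecord F N).ν (theta13LiveOfRecord F N).τ9 (EOfRecord₁₃ F N (theta13LiveOfRecord F N))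
          (wOfRecord₉ F N (theta13LiveOfRecord F N).toStage9Params) (theta13LiveOfRecord F N).ppSel p (gOfRecord₁₃ F N (theta13LiveOfRecord F N) p) (k + 1) s ≠ 0 →
        PresentChildObligations (⟨⟨theta13LiveOfRecord F N, Zr⟩, Zh, Phih⟩ : Stage13HParams F N) p k (chainWitness _ p σ k).1
          (σ k (chainWitness _ p σ k).1 (chainWitness _ p σ k).2).1 (σ k (chainWitness _ p σ k).1 (chainWitness _ p σ k).2).2 s) ∧
      NoExpansionClauseFor (⟨⟨theta13LiveOfRecord F N, Zr⟩, Zh, Phih⟩ : Stage13HParams F N) p k (chainWitness _ p σ k).1 (chainWitness _ p σ k).2) :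
    ∀ k, k ≤ k₀ → SLaw₁₃CoPH F N (⟨⟨theta13LiveOfRecord F N, Zr⟩, Zh, Phih⟩ : Stage13HParams F N) p k :=
  sLaw₁₃CoPH_of_links_below hrec rfl (admissible_theta13LiveOfRecord F N)
    (kappa_nonneg_theta13LiveOfFamily F N eps0OfRecord₁₃ (zeta316OfRecord F N (numerics7OfFamily eps0OfRecord₁₃) 1 1) (RzOfRecord F N) (ZtOfRecord F N))
    (E0_nonneg_theta13LiveOfFamily F N eps0OfRecord₁₃ (zeta316OfRecord F N (numerics7OfFamily eps0OfRecord₁₃) 1 1) (RzOfRecord F N) (ZtOfRecord F N))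
    (B0_nonneg_theta13LiveOfFamily F N eps0OfRecord₁₃ (zeta316OfRecord F N (numerics7OfFamily eps0OfRecord₁₃) 1 1) (RzOfRecord F N) (ZtOfRecord F N))
    (le_of_eq rfl) σ k₀ hk₀ hlinks

end Record

end Summit.QuantumFields.YangMills.Theorems.BalabanUVNodesN11SupplyChainLevelByLevel

end
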